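import Literature.Probability.Percolation.LoopRotationInvarianceAssembly
import Literature.Probability.RandomPlanarGeometry.LoopMatching
import HarnessLib

/-!
# Closed polygons with all vertices as base points are rebasable

Layer N2 (deterministic part) of the decomposition of `dkkmo_rotation_invariance` (crit-perc.S25):
the side condition `TypedLoops.Rebasable` of `LoopMatching` for families of *closed polygons*
entered with every vertex as a base point — the convention of crit-perc.S25, where each interface
loop `γ` enters `bondLoopCollection` through all its rotations `γ.rotate k`.

* `affineInterp_eq_lineMap`: on `[j, j+1]` the affine interpolation is the segment between the
  `j`-th and `(j+1)`-st points; `dist_affineInterp_le`: it is `D`-Lipschitz on `[0, length - 1]`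
  when consecutive points are `D`-close.
* `uniformCurve L`: the polyline through `L` traversed at uniform speed (segment `j` during
  `[j/m, (j+1)/m]`); `reparamDist_polyline_uniformCurve`: it is a reparametrisation of the
  prelude's dyadic `polyline L` (distance `0`), so `CurveClass.mk ⟨polyline L⟩ = mk (uniformCurve L)`.
* `closedPolygon pts := CurveClass.mk ⟨polyline (pts ++ pts.take 1)⟩` (the form of `loopCurve`,
  `isoRectLoopCurve`); `closedPolygon_rotate`: **rebasing at vertex `k` is the shift by `k/n`**,
  `closedPolygon (pts.rotate k) = mk ((uniform closed curve).shift (k/n))`.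
* `Curve.dist_shift_apply_le`, `Curve.reparamDist_shift_shift_le`: for a loop which is
  `K`-Lipschitz in time, shifts by `b ≤ b'` are at (sup, reparametrisation) distance `≤ K (b' - b)`; hence (`exists_rotate_dist_le`) for every based loop `c`:
  some vertex-rebasing of the polygon is at based distance `≤ loopDist c (closedPolygon pts) + D + θ`
  (`D` = longest edge, any `θ > 0`), i.e. rotation-closed families of closed polygons with edges
  `≤ D` are `Rebasable (D + θ)` (`TypedLoops.rebasable_of_closedPolygon`).

## References

* F. Camia, C. M. Newman, Comm. Math. Phys. 268 (2006), §2 (lattice loops as polygonal curves).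
* H. Duminil-Copin et al., arXiv:2012.11672v2 (2026), §1.2 (unbased loops, eq. (1)).
-/

noncomputable section

open Set Metric
open scoped unitInterval

namespace Literature.Probability.Percolation

/-! ### The affine interpolation on unit intervals; Lipschitz bound -/

section Module

variable {E : Type*} [AddCommGroup E] [Module ℝ E]

/-- On `[j, j+1]` the affine interpolation through `L` is the segment from `L[j]` to `L[j+1]`. [folklore] -/
theorem affineInterp_eq_lineMap (L : List E) (j : ℕ) (hj : j + 1 < L.length) {s : ℝ}
    (hs : s ∈ Icc (j : ℝ) (j + 1)) :
    affineInterp L s = AffineMap.lineMap (L[j]'(by omega)) (L[j + 1]'hj) (s - j) := by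
  induction j generalizing L s with
  | zero =>
    obtain ⟨a, L', rfl⟩ := List.exists_cons_of_length_pos (by omega : 0 < L.length)
    obtain ⟨b, l, rfl⟩ := List.exists_cons_of_length_pos (by simpa using hj : 0 < L'.length)
    simp only [Nat.cast_zero, zero_add] at hs
    rw [affineInterp_cons_cons, if_pos hs.2]
    simp
  | succ j ih =>
    obtain ⟨a, L', rfl⟩ := List.exists_cons_of_length_pos (by omega : 0 < L.length)
    obtain ⟨b, l, rfl⟩ := List.exists_cons_of_length_pos (by simp at hj; omega : 0 < L'.length)
    rw [affineInterp_cons_cons]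
    push_cast at hs
    by_cases h1 : s ≤ 1
    · -- then `j = 0` and `s = 1`: the two adjacent segments agree at the knot
      have hj0 : j = 0 := by
        by_contra h
        have : (1 : ℝ) ≤ j := by exact_mod_cast Nat.one_le_iff_ne_zero.2 h
        linarith [hs.1]
      subst hj0
      have hs1 : s = 1 := le_antisymm h1 (by simpa using hs.1)
      subst hs1
      rw [if_pos le_rfl]
      simp
    · rw [if_neg h1]
      have h' : j + 1 < (b :: l).length := by simp at hj ⊢; omega
      rw [ih (b :: l) h' (s := s - 1) ⟨by linarith [hs.1], by linarith [hs.2]⟩]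
      simp only [List.getElem_cons_succ]
      congr 1
      push_cast
      ring

end Module

section Edges

variable {E : Type*} [PseudoMetricSpace E]

/-- A list has `D`-short edges if consecutive points are at distance `≤ D`: Mathlib's
`List.IsChain (dist · · ≤ D)` (an `abbrev`, so that the `IsChain` API — `List.isChain_cons_cons`,
`List.IsChain.getElem`, `List.isChain_iff_getElem` — applies). [folklore] -/
abbrev EdgesLE (D : ℝ) (L : List E) : Prop := L.IsChain (fun a b ↦ dist a b ≤ D)

end Edges

section Normed

variable {E : Type*} [NormedAddCommGroup E] [NormedSpace ℝ E]

/-- **Lipschitz bound.** If consecutive points of `L` are `D`-close then the affine interpolation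
is `D`-Lipschitz on `[0, length L - 1]`. [folklore] -/
theorem dist_affineInterp_le {D : ℝ} :
    ∀ (L : List E), EdgesLE D L → ∀ {s s' : ℝ}, 0 ≤ s → s ≤ s' → s' ≤ (L.length : ℝ) - 1 →
      dist (affineInterp L s) (affineInterp L s') ≤ D * (s' - s)
  | [], _, s, s', h0, hss', h1 => by simp at h1; linarith
  | [a], _, s, s', h0, hss', h1 => by
    simp only [List.length_singleton, Nat.cast_one, sub_self] at h1
    have : s = s' := le_antisymm hss' (h1.trans h0)
    simp [this]
  | a :: b :: l, hL, s, s', h0, hss', h1 => by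
    obtain ⟨hab, hL'⟩ := List.isChain_cons_cons.1 hL
    have hD : 0 ≤ D := dist_nonneg.trans hab
    have seg : ∀ {u u' : ℝ}, 0 ≤ u → u ≤ u' → u' ≤ 1 →
        dist (affineInterp (a :: b :: l) u) (affineInterp (a :: b :: l) u') ≤ D * (u' - u) := by
      intro u u' hu huu' hu'
      rw [affineInterp_cons_cons, if_pos (huu'.trans hu'), affineInterp_cons_cons, if_pos hu',
        dist_comm, dist_lineMap_lineMap, Real.dist_eq, abs_of_nonneg (by linarith)]
      calc (u' - u) * dist a b ≤ (u' - u) * D := by gcongr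
        _ = D * (u' - u) := by ring
    have tail : ∀ {u u' : ℝ}, 1 ≤ u → u ≤ u' → u' ≤ ((a :: b :: l).length : ℝ) - 1 →
        dist (affineInterp (a :: b :: l) u) (affineInterp (a :: b :: l) u') ≤ D * (u' - u) := by
      intro u u' hu huu' hu'
      rcases hu.eq_or_lt with rfl | hu1
      · -- u = 1: value is `b` on both readings
        rw [affineInterp_cons_cons, if_pos le_rfl, AffineMap.lineMap_apply_one]
        rcases huu'.eq_or_lt with rfl | h1u'
        · rw [affineInterp_cons_cons, if_pos le_rfl]; simp
        · rw [affineInterp_cons_cons, if_neg (not_le.2 h1u')]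
          have h := dist_affineInterp_le (b :: l) hL' (s := 0) (s' := u' - 1) le_rfl (by linarith)
            (by simp at hu' ⊢; linarith)
          rw [affineInterp_cons_zero] at h
          simpa using h
      · rw [affineInterp_cons_cons, if_neg (not_le.2 hu1), affineInterp_cons_cons,
          if_neg (not_le.2 (hu1.trans_le huu'))]
        have h := dist_affineInterp_le (b :: l) hL' (s := u - 1) (s' := u' - 1) (by linarith)
          (by linarith) (by simp at hu' ⊢; linarith)
        simpa using h
    by_cases hs1 : s' ≤ 1
    · exact seg h0 hss' hs1
    · by_cases hs0 : 1 ≤ s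
      · exact tail hs0 hss' h1
      · rw [not_le] at hs1 hs0
        calc dist (affineInterp (a :: b :: l) s) (affineInterp (a :: b :: l) s')
            ≤ dist (affineInterp (a :: b :: l) s) (affineInterp (a :: b :: l) 1) +
              dist (affineInterp (a :: b :: l) 1) (affineInterp (a :: b :: l) s') :=
              dist_triangle _ _ _
          _ ≤ D * (1 - s) + D * (s' - 1) := add_le_add (seg h0 hs0.le le_rfl) (tail le_rfl hs1.le h1)
          _ = D * (s' - s) := by ring

/-! ### Uniformly parametrised polylines -/

/-- The polyline through `L` traversed at uniform speed: `t ↦ affineInterp L ((length L - 1) t)`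
(segment `j` during `[j/m, (j+1)/m]`, `m = length L - 1`). Junk (constant `0`) for `L = []`. [folklore] -/
def uniformCurve (L : List E) : RandomPlanarGeometry.Curve E :=
  ⟨⟨fun t : I ↦ affineInterp L (((L.length : ℝ) - 1) * t),
    (continuous_affineInterp L).comp (by fun_prop)⟩⟩

/-- Pointwise formula for `uniformCurve`. [folklore] -/
@[simp] theorem uniformCurve_apply (L : List E) (t : I) :
    uniformCurve L t = affineInterp L (((L.length : ℝ) - 1) * t) := rfl

/-- The dyadic `polyline` of the prelude and the uniform polyline are reparametrisations of each
other: reparametrisation distance `0`. [folklore] -/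
theorem reparamDist_polyline_uniformCurve (a : E) (l : List E) :
    RandomPlanarGeometry.Curve.reparamDist ⟨LatticeModels.polyline (a :: l)⟩ (uniformCurve (a :: l)) = 0 := by
  refine RandomPlanarGeometry.Curve.reparamDist_eq_zero_of_monotone (m := l.length) (Nat.cast_nonneg _)
    (V := affineInterp (a :: l)) (continuous_affineInterp _).continuousOn
    (h₁ := dyadicTime l.length) (h₂ := fun t ↦ (l.length : ℝ) * t)
    (continuous_dyadicTime _) (by fun_prop) (monotone_dyadicTime _)
    (fun x y hxy ↦ by simp only; gcongr) (dyadicTime_apply_zero _) (by simp)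
    (dyadicTime_apply_one _) (by simp) (fun t ↦ polyline_cons_apply a l t) (fun t ↦ ?_)
  simp

/-- As curve classes, the dyadic and the uniform polylines coincide. [folklore] -/
theorem mk_polyline_eq_mk_uniformCurve (L : List E) :
    RandomPlanarGeometry.CurveClass.mk ⟨LatticeModels.polyline L⟩ = RandomPlanarGeometry.CurveClass.mk (uniformCurve L) := by
  cases L with
  | nil =>
    refine RandomPlanarGeometry.CurveClass.mk_eq_mk_iff_dist_eq_zero.2 ?_
    rw [RandomPlanarGeometry.Curve.dist_def]
    refine le_antisymm ((RandomPlanarGeometry.Curve.reparamDist_le_dist _ _).trans ?_) (RandomPlanarGeometry.Curve.reparamDist_nonneg _ _)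
    refine (ContinuousMap.dist_le le_rfl).2 fun t ↦ ?_
    change dist (LatticeModels.polyline ([] : List E) t) (affineInterp ([] : List E) ((((0:ℕ) : ℝ) - 1) * t)) ≤ 0
    simp [LatticeModels.polyline, affineInterp]
  | cons a l => exact RandomPlanarGeometry.CurveClass.mk_eq_mk_iff_dist_eq_zero.2 (reparamDist_polyline_uniformCurve a l)

/-- The uniform polyline through `a :: l` is `D · length l`-Lipschitz in time when edges are
`≤ D`. [folklore] -/
theorem dist_uniformCurve_apply_le {D : ℝ} {a : E} {l : List E} (hL : EdgesLE D (a :: l))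
    {t t' : I} (htt' : t ≤ t') :
    dist (uniformCurve (a :: l) t) (uniformCurve (a :: l) t') ≤ D * l.length * ((t' : ℝ) - t) := by
  have hlen : (((a :: l).length : ℝ) - 1) = l.length := by push_cast [List.length_cons]; ring
  simp only [uniformCurve_apply, hlen]
  have h := dist_affineInterp_le (a :: l) hL (s := l.length * t) (s' := l.length * t')
    (by have := t.2.1; positivity) (by have : (t : ℝ) ≤ t' := htt'; gcongr)
    (by rw [hlen]; have := t'.2.2; nlinarith [Nat.cast_nonneg (α := ℝ) l.length])
  calc _ ≤ D * (l.length * t' - l.length * t) := h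
    _ = D * l.length * ((t' : ℝ) - t) := by ring

end Normed

section ListLemmas

variable {E : Type*}

/-- The vertex list of the closed polygon, read cyclically: `(pts ++ pts.take 1)[j] = pts[j % n]`
for `j ≤ n = length pts`. [folklore] -/
theorem getElem_append_take_one {pts : List E} (hn : pts ≠ []) {j : ℕ} (hj : j ≤ pts.length) :
    (pts ++ pts.take 1)[j]'(by simp [List.length_take, Nat.min_eq_left (List.length_pos_iff.2 hn)]; omega) =
      pts[j % pts.length]'(Nat.mod_lt _ (List.length_pos_iff.2 hn)) := by
  have hn' : 0 < pts.length := List.length_pos_iff.2 hn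
  rcases hj.lt_or_eq with hj' | rfl
  · rw [List.getElem_append_left hj']
    congr 1
    exact (Nat.mod_eq_of_lt hj').symm
  · rw [List.getElem_append_right le_rfl]
    simp [Nat.mod_self]

/-- Length bookkeeping: `length (pts ++ pts.take 1) - 1 = length pts` for `pts ≠ []`. [folklore] -/
theorem length_append_take_one {pts : List E} (hn : pts ≠ []) :
    (((pts ++ pts.take 1).length : ℝ) - 1) = pts.length := by
  have hn' : 0 < pts.length := List.length_pos_iff.2 hn
  rw [List.length_append, List.length_take, Nat.min_eq_left (by omega)]
  push_cast; ring

end ListLemmas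

section Normed

variable {E : Type*} [NormedAddCommGroup E] [NormedSpace ℝ E]

/-! ### Values at the knots; closed polygons -/

/-- Dropping the first segment: `affineInterp (a :: b :: l) (j + 1) = affineInterp (b :: l) j`. [folklore] -/
theorem affineInterp_cons_cons_succ (a b : E) (l : List E) (j : ℕ) :
    affineInterp (a :: b :: l) ((j : ℝ) + 1) = affineInterp (b :: l) j := by
  rw [affineInterp_cons_cons]
  rcases Nat.eq_zero_or_pos j with rfl | hj
  · simp
  · have : ¬ ((j : ℝ) + 1 ≤ 1) := by
      have : (1 : ℝ) ≤ j := by exact_mod_cast hj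
      linarith
    rw [if_neg this, add_sub_cancel_right]

/-- At the integer knot `j` the affine interpolation passes through `L[j]`. [folklore] -/
theorem affineInterp_natCast : ∀ (L : List E) (j : ℕ) (hj : j < L.length), affineInterp L j = L[j]
  | [], j, hj => by simp at hj
  | [a], j, hj => by
    have : j = 0 := by simpa using hj
    subst this; simp
  | a :: b :: l, 0, _ => by simp
  | a :: b :: l, j + 1, hj => by
    rw [Nat.cast_succ, affineInterp_cons_cons_succ, affineInterp_natCast (b :: l) j (by simpa using hj)]
    rfl

/-- **The closed polygon through `pts`** as a curve class: the prelude's dyadic `polyline` through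
`pts ++ pts.take 1` (back to the first vertex) — the form of `loopCurve` and `isoRectLoopCurve`
in crit-perc.S25. [folklore] -/
def closedPolygon (pts : List E) : RandomPlanarGeometry.CurveClass E := RandomPlanarGeometry.CurveClass.mk ⟨LatticeModels.polyline (pts ++ pts.take 1)⟩

/-- The uniformly parametrised representative of `closedPolygon pts`. [folklore] -/
def closedCurve (pts : List E) : RandomPlanarGeometry.Curve E := uniformCurve (pts ++ pts.take 1)

/-- `closedPolygon pts` is the class of `closedCurve pts`. [folklore] -/
theorem closedPolygon_eq_mk_closedCurve (pts : List E) :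
    closedPolygon pts = RandomPlanarGeometry.CurveClass.mk (closedCurve pts) :=
  mk_polyline_eq_mk_uniformCurve _

/-- Pointwise formula for `closedCurve`. [folklore] -/
theorem closedCurve_apply {pts : List E} (hn : pts ≠ []) (t : I) :
    closedCurve pts t = affineInterp (pts ++ pts.take 1) (pts.length * t) := by
  rw [closedCurve, uniformCurve_apply, length_append_take_one hn]

/-- **The closed polygon on its `j`-th edge** (`j < n`, cyclic indices): for `s ∈ [j, j + 1]`,
`affineInterp (pts ++ pts.take 1) s` is the point of parameter `s - j` on the segment from
`pts[j % n]` to `pts[(j + 1) % n]`. [folklore] -/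
theorem affineInterp_closed_eq_lineMap {pts : List E} (hn : pts ≠ []) {j : ℕ} (hj : j < pts.length)
    {s : ℝ} (hs : s ∈ Icc (j : ℝ) (j + 1)) :
    affineInterp (pts ++ pts.take 1) s =
      AffineMap.lineMap (pts[j % pts.length]'(Nat.mod_lt _ (List.length_pos_iff.2 hn)))
        (pts[(j + 1) % pts.length]'(Nat.mod_lt _ (List.length_pos_iff.2 hn))) (s - j) := by
  have hn' : 0 < pts.length := List.length_pos_iff.2 hn
  have hlen : (pts ++ pts.take 1).length = pts.length + 1 := by
    rw [List.length_append, List.length_take, Nat.min_eq_left (by omega)]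
  rw [affineInterp_eq_lineMap _ j (by rw [hlen]; omega) hs, getElem_append_take_one hn hj.le,
    getElem_append_take_one hn (by omega)]

/-- `closedCurve pts` is a loop. [folklore] -/
theorem isLoop_closedCurve (pts : List E) : (closedCurve pts).IsLoop := by
  rcases eq_or_ne pts [] with rfl | hn
  · simp [RandomPlanarGeometry.Curve.isLoop_iff, RandomPlanarGeometry.Curve.source_def, RandomPlanarGeometry.Curve.target_def, closedCurve, uniformCurve_apply,
      affineInterp]
  have hn' : 0 < pts.length := List.length_pos_iff.2 hn
  have hlen : (pts ++ pts.take 1).length = pts.length + 1 := by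
    rw [List.length_append, List.length_take, Nat.min_eq_left (by omega)]
  rw [RandomPlanarGeometry.Curve.isLoop_iff, RandomPlanarGeometry.Curve.source_def, RandomPlanarGeometry.Curve.target_def, closedCurve_apply hn,
    closedCurve_apply hn]
  simp only [Set.Icc.coe_zero, mul_zero, Set.Icc.coe_one, mul_one]
  rw [show (0 : ℝ) = ((0 : ℕ) : ℝ) by simp, affineInterp_natCast _ 0 (by rw [hlen]; omega),
    affineInterp_natCast _ pts.length (by rw [hlen]; omega), getElem_append_take_one hn le_rfl,
    getElem_append_take_one hn (Nat.zero_le _)]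
  simp [Nat.mod_self]

/-- `closedPolygon pts` is a loop class. [folklore] -/
theorem isLoop_closedPolygon (pts : List E) : (closedPolygon pts).IsLoop := by
  rw [closedPolygon_eq_mk_closedCurve, RandomPlanarGeometry.CurveClass.isLoop_mk]; exact isLoop_closedCurve pts

/-- The trace of `closedPolygon pts` is the trace of `closedCurve pts`. [folklore] -/
theorem range_closedPolygon (pts : List E) : (closedPolygon pts).range = (closedCurve pts).range := by
  rw [closedPolygon_eq_mk_closedCurve, RandomPlanarGeometry.CurveClass.range_mk]

/-! ### Rebasing at a vertex is a shift -/

/-- **Rebasing at vertex `k` is the shift by `k/n`.** For `k < n = length pts`, the uniformly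
parametrised closed polygon through the rotated vertex list `pts.rotate k` is, pointwise, the
closed polygon through `pts` started at time `k/n`. [folklore] -/
theorem closedCurve_rotate {pts : List E} (hn : pts ≠ []) {k : ℕ} (hk : k < pts.length) :
    closedCurve (pts.rotate k) = (closedCurve pts).shift ((k : ℝ) / pts.length) := by
  have hn' : 0 < pts.length := List.length_pos_iff.2 hn
  have hnR : (0 : ℝ) < pts.length := by exact_mod_cast hn'
  have hkR : (k : ℝ) < pts.length := by exact_mod_cast hk
  have hrot : pts.rotate k ≠ [] := by simpa using hn
  have hlen : (pts ++ pts.take 1).length = pts.length + 1 := by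
    rw [List.length_append, List.length_take, Nat.min_eq_left (by omega)]
  have hlenr : (pts.rotate k ++ (pts.rotate k).take 1).length = pts.length + 1 := by
    rw [List.length_append, List.length_take, List.length_rotate, Nat.min_eq_left (by omega)]
  apply DFunLike.coe_injective
  funext t
  rw [RandomPlanarGeometry.Curve.shift_apply (isLoop_closedCurve pts), RandomPlanarGeometry.Curve.loopMap_coe_eq, closedCurve_apply hrot,
    closedCurve_apply hn, List.length_rotate]
  -- the integer part of `t + k/n` and the value of `n · fract (t + k/n)`
  have hx : (t : ℝ) + k / pts.length = (pts.length * t + k) / pts.length := by field_simp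
  have hfract : (pts.length : ℝ) * Int.fract ((t : ℝ) + k / pts.length) =
      pts.length * t + k - pts.length * (⌊(pts.length * (t : ℝ) + k) / pts.length⌋ : ℝ) := by
    rw [Int.fract, hx, mul_sub, mul_div_cancel₀ _ hnR.ne']
  rcases eq_or_lt_of_le t.2.2 with ht1 | ht1
  · -- `t = 1`: both sides are the vertex `pts[k]`
    have ht1' : (t : ℝ) = 1 := ht1
    have hfl : ⌊((pts.length : ℝ) * t + k) / pts.length⌋ = 1 := by
      rw [ht1', mul_one, Int.floor_eq_iff]
      constructor
      · rw [Int.cast_one, le_div_iff₀ hnR]; linarith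
      · rw [Int.cast_one, div_lt_iff₀ hnR]; linarith
    rw [hfract, hfl, ht1']
    simp only [mul_one, Int.cast_one, add_sub_cancel_left]
    rw [affineInterp_natCast _ pts.length (by rw [hlenr]; omega),
      affineInterp_natCast _ k (by rw [hlen]; omega),
      getElem_append_take_one hrot (j := pts.length) (by simp), getElem_append_take_one hn hk.le]
    simp [List.getElem_rotate, Nat.mod_eq_of_lt hk]
  -- `t < 1`: `s = n t < n`
  set s : ℝ := pts.length * (t : ℝ) with hs_def
  have hs0 : 0 ≤ s := mul_nonneg hnR.le t.2.1
  have hsn : s < pts.length := by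
    have : (pts.length : ℝ) * t < pts.length * 1 := by gcongr
    simpa using this
  by_cases hm : s + k < pts.length
  · -- no wrap
    have hfl : ⌊(s + (k : ℝ)) / pts.length⌋ = 0 := by
      rw [Int.floor_eq_iff]; constructor
      · simp only [Int.cast_zero]; positivity
      · simp only [Int.cast_zero, zero_add]; rwa [div_lt_one hnR]
    rw [hfract, hfl, Int.cast_zero, mul_zero, sub_zero]
    set j : ℕ := ⌊s⌋₊ with hj_def
    have hsj : s ∈ Icc (j : ℝ) (j + 1) := ⟨Nat.floor_le hs0, (Nat.lt_floor_add_one s).le⟩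
    have hjk : j + k < pts.length := by
      have : (j : ℝ) + k < pts.length := by linarith [hsj.1]
      exact_mod_cast this
    have hjn : j < pts.length := by omega
    rw [affineInterp_closed_eq_lineMap hrot (by rwa [List.length_rotate]) hsj,
      affineInterp_closed_eq_lineMap hn hjk (s := s + k)
        ⟨by push_cast; linarith [hsj.1], by push_cast; linarith [hsj.2]⟩]
    simp only [List.length_rotate, List.getElem_rotate]
    have e1 : (j % pts.length + k) % pts.length = (j + k) % pts.length := by
      rw [Nat.mod_eq_of_lt hjn]
    have e2 : ((j + 1) % pts.length + k) % pts.length = (j + k + 1) % pts.length := by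
      rw [Nat.mod_add_mod, Nat.add_right_comm]
    have e3 : s + k - ((j + k : ℕ) : ℝ) = s - j := by push_cast; ring
    simp only [e1, e2, e3]
  · -- wrap: `s + k ≥ n`; read both sides on the edge of `s₂ := s + k - n ∈ [0, k)`
    rw [not_lt] at hm
    have hfl : ⌊(s + (k : ℝ)) / pts.length⌋ = 1 := by
      rw [Int.floor_eq_iff]; constructor
      · simp only [Int.cast_one]; rwa [one_le_div hnR]
      · simp only [Int.cast_one]; rw [div_lt_iff₀ hnR]; linarith
    rw [hfract, hfl, Int.cast_one, mul_one]
    set s₂ : ℝ := s + k - pts.length with hs₂_def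
    have hs₂0 : 0 ≤ s₂ := by simp only [hs₂_def]; linarith
    have hs₂k : s₂ < k := by simp only [hs₂_def]; linarith
    set j₂ : ℕ := ⌊s₂⌋₊ with hj₂_def
    have hsj₂ : s₂ ∈ Icc (j₂ : ℝ) (j₂ + 1) := ⟨Nat.floor_le hs₂0, (Nat.lt_floor_add_one s₂).le⟩
    have hj₂k : j₂ < k := by
      have : (j₂ : ℝ) < k := (Nat.floor_le hs₂0).trans_lt hs₂k
      exact_mod_cast this
    -- edge index for `s` on the rotated polygon
    have hjlt : j₂ + pts.length - k < pts.length := by omega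
    have hsj : s ∈ Icc ((j₂ + pts.length - k : ℕ) : ℝ) ((j₂ + pts.length - k : ℕ) + 1) := by
      rw [Nat.cast_sub (by omega), Nat.cast_add]
      constructor <;> simp only [hs₂_def] at hsj₂ <;> linarith [hsj₂.1, hsj₂.2]
    rw [affineInterp_closed_eq_lineMap hrot (by rwa [List.length_rotate]) hsj,
      affineInterp_closed_eq_lineMap hn (hj₂k.trans hk) hsj₂]
    simp only [List.length_rotate, List.getElem_rotate]
    have e1 : ((j₂ + pts.length - k) % pts.length + k) % pts.length = j₂ % pts.length := by
      rw [Nat.mod_add_mod, show j₂ + pts.length - k + k = j₂ + pts.length by omega,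
        Nat.add_mod_right]
    have e2 : ((j₂ + pts.length - k + 1) % pts.length + k) % pts.length = (j₂ + 1) % pts.length := by
      rw [Nat.mod_add_mod, show j₂ + pts.length - k + 1 + k = (j₂ + 1) + pts.length by omega,
        Nat.add_mod_right]
    have e3 : s - ((j₂ + pts.length - k : ℕ) : ℝ) = s₂ - j₂ := by
      rw [Nat.cast_sub (by omega), Nat.cast_add]; simp only [hs₂_def]; ring
    simp only [e1, e2, e3]

/-- Hence, as classes: rebasing the closed polygon at vertex `k` is the class of the shifted
uniform representative. [folklore] -/
theorem closedPolygon_rotate {pts : List E} (hn : pts ≠ []) {k : ℕ} (hk : k < pts.length) :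
    closedPolygon (pts.rotate k) =
      RandomPlanarGeometry.CurveClass.mk ((closedCurve pts).shift ((k : ℝ) / pts.length)) := by
  rw [closedPolygon_eq_mk_closedCurve, closedCurve_rotate hn hk]

end Normed

end Literature.Probability.Percolation

/-! ### Shifts of Lipschitz loops -/

namespace Literature.Probability.Percolation
section Curve
open Literature.Probability.RandomPlanarGeometry (Curve)
open Literature.Probability.RandomPlanarGeometry.Curve

variable {E : Type*} [PseudoMetricSpace E]

/-- **Nearby base points give nearby based loops.** If the loop `β` is `K`-Lipschitz in time
(`dist (β x) (β y) ≤ K (y - x)` for `x ≤ y`), then for `b ≤ b' ≤ b + 1` the shifted loops satisfy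
`dist (β.shift b t) (β.shift b' t) ≤ K (b' - b)` for all `t` (across the base point, the loop
closes up). [folklore] -/
theorem _root_.Literature.Probability.RandomPlanarGeometry.Curve.dist_shift_apply_le {β : Curve E} (hβ : β.IsLoop) {K : ℝ}
    (hK : ∀ x y : I, x ≤ y → dist (β x) (β y) ≤ K * ((y : ℝ) - x)) {b b' : ℝ} (hbb' : b ≤ b')
    (hb'b : b' ≤ b + 1) (t : I) :
    dist (β.shift b t) (β.shift b' t) ≤ K * (b' - b) := by
  rw [shift_apply hβ, shift_apply hβ, loopMap_coe_eq, loopMap_coe_eq]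
  set x : ℝ := (t : ℝ) + b
  set x' : ℝ := (t : ℝ) + b'
  have hfl : ⌊x'⌋ = ⌊x⌋ ∨ ⌊x'⌋ = ⌊x⌋ + 1 := by
    have h1 : ⌊x⌋ ≤ ⌊x'⌋ := Int.floor_mono (by simp only [x, x']; linarith)
    have h2 : ⌊x'⌋ ≤ ⌊x⌋ + 1 := by
      rw [← Int.floor_add_one]; exact Int.floor_mono (by simp only [x, x']; linarith)
    omega
  rcases hfl with h | h
  · -- same lap
    have hle : Int.fract x ≤ Int.fract x' := by
      rw [Int.fract, Int.fract, h]; simp only [x, x']; linarith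
    refine (hK _ _ hle).trans ?_
    simp only [Int.fract, h, x, x']
    linarith
  · -- `x'` is one lap ahead: go through the base point `β 1 = β 0`
    have heq : Int.fract x' = Int.fract x + (b' - b) - 1 := by
      rw [Int.fract, Int.fract, h]; push_cast; simp only [x, x']; ring
    have hle : Int.fract x' ≤ Int.fract x := by linarith [heq]
    set P : I := ⟨Int.fract x, Int.fract_nonneg _, (Int.fract_lt_one _).le⟩
    set Q : I := ⟨Int.fract x', Int.fract_nonneg _, (Int.fract_lt_one _).le⟩
    calc dist (β P) (β Q) ≤ dist (β P) (β 1) + dist (β 0) (β Q) := by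
          rw [show β 0 = β 1 from hβ]; exact dist_triangle _ _ _
      _ ≤ K * (1 - Int.fract x) + K * (Int.fract x' - 0) := by
          gcongr
          · simpa using hK P 1 P.2.2
          · simpa using hK 0 Q Q.2.1
      _ = K * (b' - b) := by rw [heq]; ring

/-- Hence `reparamDist (β.shift b) (β.shift b') ≤ K (b' - b)` for `b ≤ b' ≤ b + 1`. [folklore] -/
theorem _root_.Literature.Probability.RandomPlanarGeometry.Curve.reparamDist_shift_shift_le {β : Curve E} (hβ : β.IsLoop) {K : ℝ} (hK0 : 0 ≤ K)
    (hK : ∀ x y : I, x ≤ y → dist (β x) (β y) ≤ K * ((y : ℝ) - x)) {b b' : ℝ} (hbb' : b ≤ b')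
    (hb'b : b' ≤ b + 1) :
    reparamDist (β.shift b) (β.shift b') ≤ K * (b' - b) :=
  (reparamDist_le_dist _ _).trans <|
    (ContinuousMap.dist_le (mul_nonneg hK0 (sub_nonneg.2 hbb'))).2 fun t ↦
      dist_shift_apply_le hβ hK hbb' hb'b t

end Curve
end Literature.Probability.Percolation

/-! ### Rebasing closed polygons -/

namespace Literature.Probability.Percolation

variable {E : Type*} [NormedAddCommGroup E] [NormedSpace ℝ E]

/-- **Rebasing theorem.** Let the closed polygon through `pts ≠ []` have edges (cyclically)
`≤ D`. For every based loop class `c` and `θ > 0` there is a vertex `k` such that the polygon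
rebased at `pts[k]` is at *based* distance `≤ loopDist c (closedPolygon pts) + D + θ` from `c`:
an almost optimal change of base point may be moved to the preceding vertex at cost `≤ D`. [folklore] -/
theorem exists_rotate_dist_le {pts : List E} (hn : pts ≠ []) {D : ℝ}
    (hD : EdgesLE D (pts ++ pts.take 1)) (c : RandomPlanarGeometry.CurveClass E) {θ : ℝ} (hθ : 0 < θ) :
    ∃ k < pts.length,
      dist c (closedPolygon (pts.rotate k)) ≤ RandomPlanarGeometry.CurveClass.loopDist c (closedPolygon pts) + D + θ := by
  have hn' : 0 < pts.length := List.length_pos_iff.2 hn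
  have hnR : (0 : ℝ) < pts.length := by exact_mod_cast hn'
  obtain ⟨α, rfl⟩ := RandomPlanarGeometry.CurveClass.surjective_mk c
  set β := closedCurve pts with hβ_def
  have hβ : β.IsLoop := isLoop_closedCurve pts
  have hcp : closedPolygon pts = RandomPlanarGeometry.CurveClass.mk β := closedPolygon_eq_mk_closedCurve pts
  -- an almost optimal shift
  have hlt : RandomPlanarGeometry.Curve.loopDist α β < RandomPlanarGeometry.Curve.loopDist α β + θ := by linarith
  obtain ⟨b, hb⟩ := exists_lt_of_ciInf_lt hlt
  -- the vertex at or before `b`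
  obtain ⟨k, hk, hkb, hbk⟩ : ∃ k : ℕ, k < pts.length ∧ (k : ℝ) / pts.length ≤ b ∧
      (b : ℝ) ≤ k / pts.length + 1 / pts.length := by
    have hb0 : 0 ≤ (pts.length : ℝ) * b := by have := b.2.1; positivity
    rcases lt_or_eq_of_le b.2.2 with hb1 | hb1
    · refine ⟨⌊(pts.length : ℝ) * b⌋₊, ?_, ?_, ?_⟩
      · have h1 : (pts.length : ℝ) * b < pts.length := by
          have : (pts.length : ℝ) * b < pts.length * 1 := by gcongr
          simpa using this
        have : ((⌊(pts.length : ℝ) * b⌋₊ : ℕ) : ℝ) < pts.length := (Nat.floor_le hb0).trans_lt h1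
        exact_mod_cast this
      · rw [div_le_iff₀ hnR]; linarith [Nat.floor_le hb0]
      · rw [← add_div, le_div_iff₀ hnR]; linarith [Nat.lt_floor_add_one ((pts.length : ℝ) * b)]
    · refine ⟨pts.length - 1, by omega, ?_, ?_⟩
      · rw [hb1, div_le_one hnR, Nat.cast_sub (by omega : 1 ≤ pts.length)]; simp
      · rw [hb1, ← add_div, Nat.cast_sub (by omega : 1 ≤ pts.length), Nat.cast_one, sub_add_cancel,
          div_self hnR.ne']
  refine ⟨k, hk, ?_⟩
  have hbk1 : (b : ℝ) ≤ k / pts.length + 1 := by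
    have : (1 : ℝ) / pts.length ≤ 1 := by rw [div_le_one hnR]; exact_mod_cast hn'
    linarith
  -- the polygon has `D`-edges, so `β` is `D n`-Lipschitz in time
  obtain ⟨a, l, hal⟩ : ∃ a l, pts ++ pts.take 1 = a :: l := List.exists_cons_of_ne_nil (by simp [hn])
  have hl' : l.length = pts.length := by
    have h := congrArg List.length hal
    rw [List.length_append, List.length_take, Nat.min_eq_left (by omega), List.length_cons] at h
    omega
  have hl : (l.length : ℝ) = pts.length := by exact_mod_cast hl'
  have hDn : 0 ≤ D := by
    have h01 : 0 + 1 < (pts ++ pts.take 1).length := by rw [hal, List.length_cons]; omega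
    exact dist_nonneg.trans (hD.getElem 0 h01)
  have hK : ∀ x y : I, x ≤ y → dist (β x) (β y) ≤ D * pts.length * ((y : ℝ) - x) := by
    intro x y hxy
    have h := dist_uniformCurve_apply_le (hal ▸ hD) hxy
    rw [← hal, hl] at h
    exact h
  calc dist (RandomPlanarGeometry.CurveClass.mk α) (closedPolygon (pts.rotate k))
      = RandomPlanarGeometry.Curve.reparamDist α (β.shift ((k : ℝ) / pts.length)) := by rw [closedPolygon_rotate hn hk]; rfl
    _ ≤ RandomPlanarGeometry.Curve.reparamDist α (β.shift b) +
          RandomPlanarGeometry.Curve.reparamDist (β.shift b) (β.shift ((k : ℝ) / pts.length)) :=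
        RandomPlanarGeometry.Curve.reparamDist_triangle _ _ _
    _ ≤ (RandomPlanarGeometry.Curve.loopDist α β + θ) + D * pts.length * ((b : ℝ) - k / pts.length) := by
        gcongr
        rw [RandomPlanarGeometry.Curve.reparamDist_comm]
        exact RandomPlanarGeometry.Curve.reparamDist_shift_shift_le hβ (by positivity) hK hkb hbk1
    _ ≤ (RandomPlanarGeometry.Curve.loopDist α β + θ) + D := by
        gcongr
        calc D * pts.length * ((b : ℝ) - k / pts.length) ≤ D * pts.length * (1 / pts.length) := by
              gcongr; linarith
          _ = D := by field_simp
    _ = RandomPlanarGeometry.CurveClass.loopDist (RandomPlanarGeometry.CurveClass.mk α) (closedPolygon pts) + D + θ := by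
        rw [hcp, RandomPlanarGeometry.CurveClass.loopDist_mk]; ring

/-- The trace of a rebased closed polygon is the trace of the polygon. [folklore] -/
theorem range_closedPolygon_rotate {pts : List E} (hn : pts ≠ []) {k : ℕ} (hk : k < pts.length) :
    (closedPolygon (pts.rotate k)).range = (closedPolygon pts).range := by
  rw [closedPolygon_rotate hn hk, RandomPlanarGeometry.CurveClass.range_mk, RandomPlanarGeometry.Curve.range_shift, range_closedPolygon]

end Literature.Probability.Percolation

/-! ### Rotation-closed families of closed polygons are rebasable -/

namespace Literature.Probability.Percolation
section TypedLoops
open Literature.Probability.RandomPlanarGeometry (TypedLoops)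
open Literature.Probability.RandomPlanarGeometry.TypedLoops

open LatticeModels Percolation

variable {E : Type*} [NormedAddCommGroup E] [NormedSpace ℝ E]

/-- **Rotation-closed families of closed polygons are rebasable** (`LoopMatching`): if every
member of `T.S i` is a closed polygon with (cyclic) edges `≤ D` all of whose vertex-rebasings are
again members of `T.S i` — the all-darts convention of crit-perc.S25 — then `T` is
`Rebasable (D + θ)` for every `θ > 0`. [folklore] -/
theorem _root_.Literature.Probability.RandomPlanarGeometry.TypedLoops.rebasable_of_closedPolygon (T : TypedLoops E) {D θ : ℝ} (hθ : 0 < θ)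
    (h : ∀ i, ∀ c ∈ T.S i, ∃ pts : List E, pts ≠ [] ∧ EdgesLE D (pts ++ pts.take 1) ∧
      c = closedPolygon pts ∧ ∀ k < pts.length, closedPolygon (pts.rotate k) ∈ T.S i) :
    T.Rebasable (D + θ) := by
  intro c i c' hc'
  obtain ⟨pts, hn, hD, rfl, hrot⟩ := h i c' hc'
  obtain ⟨k, hk, hdist⟩ := exists_rotate_dist_le hn hD c hθ
  exact ⟨closedPolygon (pts.rotate k), hrot k hk, range_closedPolygon_rotate hn hk, by linarith⟩

end TypedLoops
end Literature.Probability.Percolation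

end
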